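import Summits.Ventures.LatticeQCDFlow.Scoring.OnePlaquetteSU3Moments
import Summits.Ventures.LatticeQCDFlow.Scoring.U1TorusCharacterFormula
import Mathlib.LinearAlgebra.Matrix.Determinant.Basic
import Mathlib.MeasureTheory.Integral.Prod
import HarnessLib

/-!
# The SU(3) one-plaquette integral in Bessel form: `Z₃(β) = 6 (2π)² Σ_{q ∈ ℤ} det[I_{|q+i−j|}(β/3)]_{i,j<3}`

HONEST FRAMING: exact (Metropolis-corrected) sampling algorithms for lattice gauge theory;
figures of merit are autocorrelation/cost numbers at stated couplings and volumes; no
continuum-physics claim.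

Venture `LatticeQCDFlow` (cell pub-lqcd), sub-topic `Scoring`; FANOUT row 5 (`s0-sun-a`, S0-C
implementation A — the 'exact 2-d plaquette oracle' column), GEN-16.  NEW WORK of the cell (placement
rule); continues `Scoring/OnePlaquetteSU3.lean` / `OnePlaquetteSU3Moments.lean` (GEN-6), whose SU(3)
one-plaquette partition function `onePlaquetteZSU3 β = ∫_0^{2π}∫_0^{2π} |Δ|² e^{(β/3) Re tr U} dθ₂ dθ₁`
(Weyl-torus form, `|Δ|² = weylSU3`, `Re tr U = reTrSU3`) was so far only enclosed by rational
certificates at `β = 4, 5, 6`.  Here it gets the CLOSED BESSEL FORM that `U(1)` (`2π I₀`) and `SU(2)`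
(`π I₁(b)/b`) have had since GEN-7/9:

* §1 `integral2_eq_setIntegral_u1TorusBox` — the iterated integral over `[0,2π]²` of a jointly
  continuous function is its integral over the torus box `(0,2π]²` of `SchwingerDysonLattice`
  (`finTwoArrow`, Fubini);
* §2 the maximal torus of `SU(3)` as an ABELIAN COMPLEX with two link angles `θ₁, θ₂` and three
  "plaquettes" `θ₁, θ₂, θ₁+θ₂ (= −θ₃)` at uniform coupling `β/3` (incidence table
  `![![1,0],![0,1],![1,1]]`, `u1WilsonWeight_su3Inc`),
  so that GEN-7's abelian duality `U1CharacterExpansion.setIntegral_cexp_mul_u1WilsonWeight` applies: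
  **`integral2_torusMode_mul_exp_reTrSU3`** —
  `∫∫ e^{i(aθ₁+bθ₂)} e^{(β/3) Re tr U} = (2π)² Σ_{q ∈ ℤ} I_{|q+a|} I_{|q+b|} I_{|q|}` (arguments `β/3`;
  the flux-conserving assignments are `(m₁, m₂, m₃) = (−q−a, −q−b, q)`);
* §3 bounds `|I_{|m|}(x)| ≤ e^{|x|}`, summability of the triple products along `ℤ`, index shifts;
* §4 **`su3_fourier_toeplitz_identity`** — the per-charge identity: after shifting the `v`-th of the
  `19` Fourier monomials `c_v e^{i(a_vθ₁+b_vθ₂)}` of `|Δ|²` (`OnePlaquetteSU3Moments.weylSU3_eq_sum`) by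
  `n₃ = −(a_v+b_v)/3` (so that it reads `e^{iΣ_k n_kθ_k}` with `n = σ − τ` over the `36` pairs of
  permutations of `|Δ|² = |Σ_σ sgn σ e^{iΣ_k σ_k θ_k}|²`), `Σ_v c_v Π_k I_{|q+n_k|} = 3!·det[I_{|q+i−j|}]`
  for every `q` (reindex `k ↦ τ⁻¹k`; checked by `ring` on the expanded `3 × 3` determinant);
* §5 **`onePlaquetteZSU3_eq_tsum_det`** — THE FORMULA
  `Z₃(β) = 6 (2π)² Σ_{q ∈ ℤ} det[I_{|q+i−j|}(β/3)]_{i,j ∈ Fin 3}`, with the intermediate mode form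
  `onePlaquetteZSU3_eq_sum_modes` and the `β = 0` check `Σ_q det[I_{|q+i−j|}(0)] = 1`
  (`Z₃(0) = 6(2π)²`, GEN-6's `integral2_weylSU3`).

This is the `N = 3` case of the classical one-link / one-plaquette integral of `SU(N)` lattice gauge
theory, `∫_{SU(N)} e^{c Re tr U} dU = Σ_{q ∈ ℤ} det[I_{q+i−j}(c)]_{1 ≤ i,j ≤ N}` (the `U(N)` integral is
the `q = 0` determinant: I. Bars, F. Green, Phys. Rev. D 20 (1979) 3311; the sum over the `U(1)`
charge `q` for `SU(N)`: R. C. Brower, P. Rossi, C.-I. Tan, Nucl. Phys. B 190 (1981) 699; J.-M. Drouffe,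
J.-B. Zuber, Phys. Rep. 102 (1983) §3; A. B. Balantekin, Phys. Rev. D 62 (2000) 085017), here as a
theorem about the cell's Weyl-torus DEFINITION `onePlaquetteZSU3` — kernel-checked from Fourier
orthogonality and the generating function `e^{x cos θ} = Σ_m I_{|m|}(x) e^{imθ}`, no representation
theory.  The plaquette expectation `⟨(1/3) Re tr U_p⟩_β` in the same form is the companion file
`Scoring/OnePlaquetteSU3PlaquetteBessel.lean`.  NOT here: Weyl's integration formula for `SU(3)`
(the Haar side), `SU(N ≥ 4)`, the 2-d torus.  Nothing is cited as a fact; no `def`, no notation.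
-/

noncomputable section

open scoped Nat
open Real MeasureTheory Set Finset Literature.Analysis.FunctionSpaces

namespace Summit.Ventures.LatticeQCDFlow.Scoring

/-! ### 1. From the square `[0,2π]²` to the torus box `(0,2π]²` -/

/-- The iterated integral of a jointly continuous function over `[0,2π]²` is its integral over the
torus box `(0,2π]²` of `SchwingerDysonLattice` (coordinates `θ 0 = θ₁`, `θ 1 = θ₂`). -/
theorem integral2_eq_setIntegral_u1TorusBox {E : Type*} [NormedAddCommGroup E] [NormedSpace ℝ E]
    {g : ℝ → ℝ → E} (hg : Continuous fun p : ℝ × ℝ => g p.1 p.2) :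
    (∫ θ₁ in (0 : ℝ)..2 * π, ∫ θ₂ in (0 : ℝ)..2 * π, g θ₁ θ₂)
      = ∫ θ in u1TorusBox 2, g (θ 0) (θ 1) := by
  haveI : IsFiniteMeasure ((volume : Measure ℝ).restrict (Set.Ioc 0 (2 * π))) :=
    isFiniteMeasure_restrict.mpr (by rw [Real.volume_Ioc]; exact ENNReal.ofReal_ne_top)
  have h2π : (0 : ℝ) ≤ 2 * π := by positivity
  -- the box integral as an integral over the product of the two one-angle measures
  have hpres := measurePreserving_finTwoArrow ((volume : Measure ℝ).restrict (Set.Ioc 0 (2 * π)))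
  have hG : (fun θ : Fin 2 → ℝ => g (θ 0) (θ 1))
      = fun θ => (fun p : ℝ × ℝ => g p.1 p.2) (MeasurableEquiv.finTwoArrow (α := ℝ) θ) := by
    funext θ
    simp [MeasurableEquiv.finTwoArrow]
  rw [volume_restrict_u1TorusBox, hG, hpres.integral_comp' (fun p : ℝ × ℝ => g p.1 p.2)]
  -- Fubini for the continuous (hence integrable) integrand on the finite product measure
  have hint : Integrable (fun p : ℝ × ℝ => g p.1 p.2)
      (((volume : Measure ℝ).restrict (Set.Ioc 0 (2 * π))).prod
        ((volume : Measure ℝ).restrict (Set.Ioc 0 (2 * π)))) := by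
    rw [Measure.prod_restrict]
    exact ((hg.continuousOn.integrableOn_compact (isCompact_Icc.prod isCompact_Icc)).mono_set
      (Set.prod_mono Set.Ioc_subset_Icc_self Set.Ioc_subset_Icc_self) :
        IntegrableOn (fun p : ℝ × ℝ => g p.1 p.2) (Set.Ioc 0 (2 * π) ×ˢ Set.Ioc 0 (2 * π)) volume)
  rw [integral_prod _ hint, ← intervalIntegral.integral_of_le h2π]
  exact intervalIntegral.integral_congr fun θ₁ _ => intervalIntegral.integral_of_le h2π

/-! ### 2. The SU(3) maximal torus as an abelian complex: two link angles, three plaquettes -/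

/-- The three "plaquette angles" of the complex are `θ₁`, `θ₂`, `θ₁ + θ₂`. -/
theorem u1PlaqAngle_su3Inc (θ : Fin 2 → ℝ) :
    u1PlaqAngle (![![(1 : ℤ), 0], ![0, 1], ![1, 1]] : Fin 3 → Fin 2 → ℤ) 0 θ = θ 0 ∧
      u1PlaqAngle (![![(1 : ℤ), 0], ![0, 1], ![1, 1]] : Fin 3 → Fin 2 → ℤ) 1 θ = θ 1 ∧
      u1PlaqAngle (![![(1 : ℤ), 0], ![0, 1], ![1, 1]] : Fin 3 → Fin 2 → ℤ) 2 θ = θ 0 + θ 1 := by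
  simp [u1PlaqAngle, Fin.sum_univ_two]

/-- The Wilson weight of the complex at uniform coupling `β/3` is the SU(3) one-plaquette weight
`e^{(β/3) Re tr U}`. -/
theorem u1WilsonWeight_su3Inc (β : ℝ) (θ : Fin 2 → ℝ) :
    u1WilsonWeight univ (![![(1 : ℤ), 0], ![0, 1], ![1, 1]] : Fin 3 → Fin 2 → ℤ) (fun _ => β / 3) θ
      = Real.exp (β / 3 * reTrSU3 (θ 0) (θ 1)) := by
  obtain ⟨h0, h1, h2⟩ := u1PlaqAngle_su3Inc θ
  rw [u1WilsonWeight, Fin.sum_univ_three, h0, h1, h2, reTrSU3]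
  ring_nf

/-- **The Fourier modes of the SU(3) one-plaquette weight**: for all integers `a, b`,
`∫_0^{2π}∫_0^{2π} e^{i(aθ₁+bθ₂)} e^{(β/3) Re tr U} dθ₂ dθ₁ = (2π)² Σ_{q ∈ ℤ} I_{|q+a|} I_{|q+b|} I_{|q|}`
(arguments `β/3`) — the abelian character expansion of `U1CharacterExpansion` on the complex
`![![1,0],![0,1],![1,1]]`, whose flux-conserving assignments are `(m₁, m₂, m₃) = (−q−a, −q−b, q)`. -/
theorem integral2_torusMode_mul_exp_reTrSU3 (β : ℝ) (a b : ℤ) :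
    (∫ θ₁ in (0 : ℝ)..2 * π, ∫ θ₂ in (0 : ℝ)..2 * π,
        torusMode a b θ₁ θ₂ * (Real.exp (β / 3 * reTrSU3 θ₁ θ₂) : ℂ))
      = (2 * π : ℂ) ^ 2 * ∑' q : ℤ, ((besselI (q + a).natAbs (β / 3)
          * besselI (q + b).natAbs (β / 3) * besselI q.natAbs (β / 3) : ℝ) : ℂ) := by
  have hcont : Continuous fun p : ℝ × ℝ =>
      torusMode a b p.1 p.2 * (Real.exp (β / 3 * reTrSU3 p.1 p.2) : ℂ) := by fun_prop
  rw [integral2_eq_setIntegral_u1TorusBox hcont]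
  -- the integrand is the probe character `c = (a, b)` times the Wilson weight of the complex
  have hfun : (fun θ : Fin 2 → ℝ =>
        torusMode a b (θ 0) (θ 1) * (Real.exp (β / 3 * reTrSU3 (θ 0) (θ 1)) : ℂ))
      = fun θ => Complex.exp ((∑ l, ((![a, b] : Fin 2 → ℤ) l : ℂ) * θ l) * Complex.I) *
          ((u1WilsonWeight univ (![![(1 : ℤ), 0], ![0, 1], ![1, 1]] : Fin 3 → Fin 2 → ℤ)
            (fun _ => β / 3) θ : ℝ) : ℂ) := by
    funext θ
    rw [u1WilsonWeight_su3Inc, torusMode, Fin.sum_univ_two]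
    simp
  rw [hfun, setIntegral_cexp_mul_u1WilsonWeight
    (![![(1 : ℤ), 0], ![0, 1], ![1, 1]] : Fin 3 → Fin 2 → ℤ) (fun _ => β / 3) ![a, b]]
  congr 1
  -- the flux-conserving assignments are parametrised by `q = m₃`
  have hP : ∀ m : Fin 3 → ℤ, (∀ l : Fin 2, (![a, b] : Fin 2 → ℤ) l
      + ∑ p, m p * (![![(1 : ℤ), 0], ![0, 1], ![1, 1]] : Fin 3 → Fin 2 → ℤ) p l = 0)
      ↔ m ∈ Set.range (fun q : ℤ => (![-(q + a), -(q + b), q] : Fin 3 → ℤ)) := by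
    intro m
    simp only [Fin.forall_fin_two, Fin.sum_univ_three, Set.mem_range]
    simp only [Matrix.cons_val_zero, Matrix.cons_val_one, Matrix.cons_val, Fin.isValue]
    constructor
    · rintro ⟨h0, h1⟩
      refine ⟨m 2, ?_⟩
      funext p
      fin_cases p <;> simp <;> omega
    · rintro ⟨q, rfl⟩
      simp
  have hinj : Function.Injective (fun q : ℤ => (![-(q + a), -(q + b), q] : Fin 3 → ℤ)) := by
    intro q q' h
    have := congr_fun h 2
    simpa using this
  rw [tsum_ite_eq_tsum_of_range _ hinj hP]
  refine tsum_congr fun q => ?_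
  simp only [Fin.prod_univ_three, Matrix.cons_val_zero, Matrix.cons_val_one, Matrix.cons_val,
    Int.natAbs_neg]
  push_cast
  ring

/-! ### 3. Triple products of Bessel functions along `ℤ`: bounds, summability, shifts -/

/-- `|I_{|m|}(x)| ≤ e^{|x|}` — one term of `Σ_{m ∈ ℤ} I_{|m|}(|x|) = e^{|x|}`. -/
theorem abs_besselI_natAbs_le_exp (m : ℤ) (x : ℝ) : |besselI m.natAbs x| ≤ Real.exp |x| := by
  rw [abs_besselI_eq_besselI_abs]
  exact le_hasSum (hasSum_besselI_natAbs |x|) m fun j _ => besselI_nonneg _ (abs_nonneg x)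

/-- The triple products `q ↦ I_{|q+a|}(x) I_{|q+b|}(x) I_{|q+d|}(x)` are summable over `ℤ`. -/
theorem summable_besselI_triple (x : ℝ) (a b d : ℤ) :
    Summable fun q : ℤ =>
      besselI (q + a).natAbs x * besselI (q + b).natAbs x * besselI (q + d).natAbs x := by
  have h : Summable fun q : ℤ => besselI (q + d).natAbs |x| :=
    (summable_besselI_natAbs |x|).comp_injective (Equiv.addRight d).injective
  refine (h.mul_left (Real.exp |x| * Real.exp |x|)).of_norm_bounded fun q => ?_
  have hle : ∀ m : ℤ, besselI m.natAbs |x| ≤ Real.exp |x| := fun m => by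
    rw [← abs_besselI_eq_besselI_abs]; exact abs_besselI_natAbs_le_exp m x
  have h0 : ∀ m : ℤ, 0 ≤ besselI m.natAbs |x| := fun m => besselI_nonneg _ (abs_nonneg x)
  rw [Real.norm_eq_abs, abs_mul, abs_mul]
  simp only [abs_besselI_eq_besselI_abs]
  have ha := hle (q + a)
  have hb := hle (q + b)
  have h0a := h0 (q + a)
  have h0b := h0 (q + b)
  have h0d := h0 (q + d)
  gcongr

/-- Shifting the summation index along `ℤ`. -/
theorem tsum_int_shift {α : Type*} [AddCommMonoid α] [TopologicalSpace α] (F : ℤ → α) (k : ℤ) :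
    ∑' q : ℤ, F q = ∑' q : ℤ, F (q + k) :=
  ((Equiv.addRight k).tsum_eq F).symm

/-! ### 4. The combinatorial identity: the 19 Fourier monomials of `|Δ|²` vs the Toeplitz determinant -/

/-- **The per-mode identity behind the determinant.**  Writing the `19` Fourier monomials
`c_v e^{i(a_v θ₁ + b_v θ₂)}` of `|Δ|²` as `e^{i Σ_k n_k θ_k}` on the three eigen-angles
(`n₃ = −(a_v + b_v)/3`, `n₁ = a_v + n₃`, `n₂ = b_v + n₃`, i.e. `n = σ − τ` for the `36` pairs of
permutations in `|Δ|² = Σ_{σ,τ} sgn σ sgn τ e^{i Σ_k (σ_k − τ_k) θ_k}`), for every `q ∈ ℤ`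
`Σ_v c_v I_{|q+n₁|} I_{|q+n₂|} I_{|q+n₃|} = 3! · det[I_{|q+i−j|}]_{i,j<3}` (reindex `k ↦ τ⁻¹ k`). -/
theorem su3_fourier_toeplitz_identity (x : ℝ) (q : ℤ) :
    ∑ v ∈ range 19, (su3wC v : ℝ) *
        (besselI (q + -((su3wA v + su3wB v) / 3) + su3wA v).natAbs x *
          besselI (q + -((su3wA v + su3wB v) / 3) + su3wB v).natAbs x *
          besselI (q + -((su3wA v + su3wB v) / 3)).natAbs x)
      = 6 * (Matrix.of fun i j : Fin 3 => besselI (q + (i : ℕ) - (j : ℕ)).natAbs x).det := by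
  simp only [sum_range_succ, sum_range_zero, su3wA, su3wB, su3wC, Matrix.det_fin_three,
    Matrix.of_apply, Fin.val_zero, Fin.val_one, Fin.val_two, Nat.cast_zero, Nat.cast_one,
    Nat.cast_ofNat, Int.reduceNeg, Int.reduceAdd, Int.reduceDiv, add_zero, sub_zero, zero_add]
  ring_nf

/-! ### 5. `Z₃(β) = 6 (2π)² Σ_{q ∈ ℤ} det[I_{|q+i−j|}(β/3)]` -/

/-- The SU(3) one-plaquette partition function as a complex double integral. -/
theorem ofReal_onePlaquetteZSU3 (β : ℝ) :
    (onePlaquetteZSU3 β : ℂ) = ∫ θ₁ in (0 : ℝ)..2 * π, ∫ θ₂ in (0 : ℝ)..2 * π,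
        (weylSU3 θ₁ θ₂ : ℂ) * (Real.exp (β / 3 * reTrSU3 θ₁ θ₂) : ℂ) := by
  rw [onePlaquetteZSU3, ← intervalIntegral.integral_ofReal]
  refine intervalIntegral.integral_congr fun θ₁ _ => ?_
  simp only [← intervalIntegral.integral_ofReal, Complex.ofReal_mul]

/-- **`Z₃` by Fourier modes**: `Z₃(β) = (2π)² Σ_{v<19} c_v Σ_{q ∈ ℤ} I_{|q+a_v|} I_{|q+b_v|} I_{|q|}`
(arguments `β/3`). -/
theorem onePlaquetteZSU3_eq_sum_modes (β : ℝ) :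
    onePlaquetteZSU3 β = ∑ v ∈ range 19, (su3wC v : ℝ) * ((2 * π) ^ 2 *
      ∑' q : ℤ, (besselI (q + su3wA v).natAbs (β / 3) * besselI (q + su3wB v).natAbs (β / 3)
          * besselI q.natAbs (β / 3))) := by
  have h1 : (onePlaquetteZSU3 β : ℂ) = ∑ v ∈ range 19, (su3wC v : ℂ) * ((2 * π : ℂ) ^ 2 *
      ∑' q : ℤ, ((besselI (q + su3wA v).natAbs (β / 3) * besselI (q + su3wB v).natAbs (β / 3)
          * besselI q.natAbs (β / 3) : ℝ) : ℂ)) := by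
    rw [ofReal_onePlaquetteZSU3]
    have hexp : ∀ θ₁ θ₂ : ℝ, (weylSU3 θ₁ θ₂ : ℂ) * (Real.exp (β / 3 * reTrSU3 θ₁ θ₂) : ℂ)
        = ∑ v ∈ range 19, (su3wC v : ℂ) * (torusMode (su3wA v) (su3wB v) θ₁ θ₂
            * (Real.exp (β / 3 * reTrSU3 θ₁ θ₂) : ℂ)) := by
      intro θ₁ θ₂
      rw [weylSU3_eq_sum, Finset.sum_mul]
      exact sum_congr rfl fun v _ => mul_assoc _ _ _
    simp_rw [hexp]
    rw [integral2_finset_sum _ (fun v _ => by fun_prop)]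
    refine sum_congr rfl fun v _ => ?_
    rw [integral2_const_mul, integral2_torusMode_mul_exp_reTrSU3]
  apply Complex.ofReal_injective
  rw [h1]
  push_cast
  rfl

/-- **THE SU(3) ONE-PLAQUETTE PARTITION FUNCTION IN BESSEL FORM.**  For every real `β`,
`Z₃(β) = ∫_0^{2π}∫_0^{2π} |Δ|² e^{(β/3) Re tr U} dθ₂ dθ₁ = 6 (2π)² Σ_{q ∈ ℤ} det[I_{|q+i−j|}(β/3)]_{i,j ∈ Fin 3}`
— the sum over the `U(1)` charge `q` of `3 × 3` Toeplitz determinants of modified Bessel functions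
(the `SU(3)` case of the Bars–Green / Brower–Rossi–Tan formula `Σ_q det I_{q+i−j}` for the `SU(N)`
one-link integral; `6 (2π)²` is the Weyl normalisation `|W| (2π)^{rank+1}` of the un-normalised torus
integral `onePlaquetteZSU3`). -/
theorem onePlaquetteZSU3_eq_tsum_det (β : ℝ) :
    onePlaquetteZSU3 β = 6 * (2 * π) ^ 2 * ∑' q : ℤ,
      (Matrix.of fun i j : Fin 3 => besselI (q + (i : ℕ) - (j : ℕ)).natAbs (β / 3)).det := by
  rw [onePlaquetteZSU3_eq_sum_modes]
  -- shift the `v`-th mode sum by `k_v = −(a_v + b_v)/3`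
  have h3 : ∀ v ∈ range 19, (su3wC v : ℝ) * ((2 * π) ^ 2 *
      ∑' q : ℤ, (besselI (q + su3wA v).natAbs (β / 3) * besselI (q + su3wB v).natAbs (β / 3)
          * besselI q.natAbs (β / 3)))
        = (2 * π) ^ 2 * ∑' q : ℤ, (su3wC v : ℝ) *
          (besselI (q + -((su3wA v + su3wB v) / 3) + su3wA v).natAbs (β / 3) *
            besselI (q + -((su3wA v + su3wB v) / 3) + su3wB v).natAbs (β / 3) *
            besselI (q + -((su3wA v + su3wB v) / 3)).natAbs (β / 3)) := by
    intro v _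
    rw [tsum_mul_left]
    conv_lhs => rw [tsum_int_shift _ (-((su3wA v + su3wB v) / 3))]
    ring
  have hsum : ∀ v ∈ range 19, Summable fun q : ℤ => (su3wC v : ℝ) *
      (besselI (q + -((su3wA v + su3wB v) / 3) + su3wA v).natAbs (β / 3) *
        besselI (q + -((su3wA v + su3wB v) / 3) + su3wB v).natAbs (β / 3) *
        besselI (q + -((su3wA v + su3wB v) / 3)).natAbs (β / 3)) := by
    intro v _
    simp_rw [add_assoc]
    exact (summable_besselI_triple (β / 3) _ _ _).mul_left _
  rw [sum_congr rfl h3, ← mul_sum, ← Summable.tsum_finsetSum hsum,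
    show (6 : ℝ) * (2 * π) ^ 2 * (∑' q : ℤ, (Matrix.of fun i j : Fin 3 =>
        besselI (q + (i : ℕ) - (j : ℕ)).natAbs (β / 3)).det)
      = (2 * π) ^ 2 * (6 * ∑' q : ℤ, (Matrix.of fun i j : Fin 3 =>
        besselI (q + (i : ℕ) - (j : ℕ)).natAbs (β / 3)).det) by ring]
  congr 1
  rw [← tsum_mul_left]
  exact tsum_congr fun q => su3_fourier_toeplitz_identity (β / 3) q

/-- **Sanity check at `β = 0`**: `det[I_{|q+i−j|}(0)] = [q = 0]`, so the formula returns
`Z₃(0) = 6 (2π)²` (`integral2_weylSU3`). -/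
theorem tsum_det_besselI_zero :
    ∑' q : ℤ, (Matrix.of fun i j : Fin 3 =>
      besselI (q + (i : ℕ) - (j : ℕ)).natAbs (0 : ℝ)).det = 1 := by
  have h := onePlaquetteZSU3_eq_tsum_det 0
  rw [zero_div] at h
  have hZ : onePlaquetteZSU3 0 = (2 * π) ^ 2 * 6 := by
    have h0 := integral2_weylSU3
    rw [onePlaquetteZSU3]
    simp only [zero_div, zero_mul, Real.exp_zero, mul_one]
    exact h0
  have hne : (6 : ℝ) * (2 * π) ^ 2 ≠ 0 := by positivity
  apply mul_left_cancel₀ hne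
  rw [← h, hZ]
  ring

end Summit.Ventures.LatticeQCDFlow.Scoring
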